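/-
Copyright (c) 2026. All rights reserved.
Released under Apache 2.0 license as described in the file LICENSE.
-/
import Literature.AlgebraicGeometry.Pohlmann1968.CMTypeRankStabilizerBoundHazamaCriterion
import HarnessLib

/-!
# Abelian CM fields: `2·|Stab(Φ)|·(Rank(Φ) − 1) = [K:ℚ]` decides whether `A` itself has exceptional Hodge classes

SETTING (tree `CMTypeRankStabilizerBound`, `CMTypeRankStabilizerBoundHazamaCriterion`).  `K` an ABELIAN CM field
(`IsAbelianGalois ℚ K`), `Φ` any CM type of `K`, `Stab(Φ) ≤ Gal(K/ℚ)` its stabiliser (tree `twistStabilizer`),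
`Rank(Φ) = cmTypeRank Φ`, `A` any abelian variety of type `(K; Φ)`.  For Galois `K` the tree decides Hazama's
dichotomy for the POWERS of `A` by the invariant `2·|Stab(Φ)|·(Rank(Φ) − 1) ≤ [K:ℚ]` (equality iff
`Bᵐ(Aⁿ) ⊗ ℂ = Dᵐ(Aⁿ) ⊗ ℂ` for all `n, m`); for ABELIAN `K` the tree also knows (S. P. White [White1993SporadicCycles]
§4 Thm. 3, F. Hazama [Hazama2003CyclicCM] Rem. 4.10; tree `forall_pow_hodgeClassSpan_eq_iff_forall_hodgeClassSpan_eq`,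
`exists_exceptional_pow_iff_exists_exceptional`) that the powers are not needed: an exceptional class on some power
exists iff one exists on `A`.  Combining:

> **Theorem** (`two_mul_natCard_twistStabilizer_mul_eq_iff_forall_hodgeClassSpan_eq`).  `K` abelian CM, `Φ` any CM
> type, `A` any abelian variety of type `(K; Φ)`:  `2·|Stab(Φ)|·(Rank(Φ) − 1) = [K:ℚ] ⟺ Bᵐ(A) ⊗ ℂ = Dᵐ(A) ⊗ ℂ`
> for all `m`; and `2·|Stab(Φ)|·(Rank(Φ) − 1) < [K:ℚ]` iff `A` ITSELF carries an exceptional Hodge class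
> (`two_mul_natCard_twistStabilizer_mul_lt_iff_exists_exceptional`).

So for abelian varieties with complex multiplication by an abelian CM field, the two integers `Rank(Φ)` and `|Stab(Φ)|`
decide the presence of exceptional (non-divisorial) Hodge classes on `A` — B. B. Gordon [Gordon1999HodgeAVSurvey]
Thm. 6.4 / §9.2 with the primitive sub-pair replaced by the stabiliser count.

* `two_mul_natCard_twistStabilizer_mul_eq_iff_forall_hodgeClassSpan_eq`, `two_mul_natCard_twistStabilizer_mul_lt_iff_exists_exceptional`,
  `exists_exceptional_of_two_mul_natCard_twistStabilizer_mul_lt`, `hodgeClassSpan_eq_or_exists_exceptional` (the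
  dichotomy on `A`), `not_exists_exceptional_of_two_mul_natCard_twistStabilizer_mul_eq`.

HONEST SCOPE.  Two-line assembly of the tree's abelian-field theorems with the stabiliser criterion; the Hodge
conjecture itself in the `<` case (algebraicity of the exceptional classes) is open and not addressed.  THEOREMS
ONLY: no definition, no named fact, no instance, no `sorry`.

## References

* [Gordon1999HodgeAVSurvey] B. B. Gordon, *A survey of the Hodge conjecture for abelian varieties*, Thm. 6.4, §9.2.
* [White1993SporadicCycles] S. P. White, *Sporadic cycles on CM abelian varieties*, Compositio Math. 88 (1993), §4 Thm. 3.
* [Hazama2003CyclicCM] F. Hazama, *Hodge cycles on abelian varieties with complex multiplication by cyclic CM-fields*, Rem. 4.10.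
* [Shimura1998] G. Shimura, *Abelian Varieties with Complex Multiplication and Modular Functions*, §8.2 Prop. 26.

## Provenance

Lane `lit-hodgefound` (Track 2, Layer A5), seat `lit-hodgefound-p10` generation 39, row g39-#9; neighbours cited by
name, nothing restated: `CMTypeRankStabilizerBoundHazamaCriterion` (g39-#8:
`two_mul_natCard_twistStabilizer_mul_eq_iff_forall_pow_hodgeClassSpan_eq`,
`exists_exceptional_pow_of_two_mul_natCard_twistStabilizer_mul_lt`), `CMTypeRankStabilizerBound` (g39-#7:
`two_mul_natCard_twistStabilizer_mul_cmTypeRank_sub_one_le`), `NonSimpleCMAbelianVarietyHazamaCriterion`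
(`forall_pow_hodgeClassSpan_eq_iff_forall_hodgeClassSpan_eq`, `exists_exceptional_pow_iff_exists_exceptional`).
-/

open scoped BigOperators NumberField Classical
open NumberField Module CategoryTheory CategoryTheory.Limits IntermediateField

namespace Literature.AlgebraicGeometry.Pohlmann1968

open scoped Literature.NumberTheory.ComplexMultiplication
open Literature.NumberTheory.ComplexMultiplication (twistStabilizer)
open Literature.AlgebraicGeometry.Motives (CMType AbelianVariety)
open Literature.AlgebraicGeometry.HodgeTheory
open Literature.AlgebraicGeometry.VanGeemen1994 (hodgeClassSpan)
open Literature.Barriers.HodgeConjecture (divisorClassesSpan)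
open Literature.AlgebraicGeometry.ComplexMultiplication (IsCMTypeRealisation)

variable {K : Type} [Field K] [NumberField K] [IsAbelianGalois ℚ K] [IsCMField K] {Φ : CMType K}
  {A : AbelianVariety ℂ} {ι : 𝓞 K →+* End A} {θ : K →+* Module.End ℂ (complexBetti A.X 1)}

/-- **`K` ABELIAN CM: `2·|Stab(Φ)|·(Rank(Φ) − 1) = [K:ℚ] ⟺ Bᵐ(A) ⊗ ℂ = Dᵐ(A) ⊗ ℂ` FOR ALL `m`** — on `A` itself,
for every abelian variety `A` of type `(K; Φ)` (Galois criterion for the powers, tree g39-#8, and «all powers iff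
`A`» for abelian fields, tree `forall_pow_hodgeClassSpan_eq_iff_forall_hodgeClassSpan_eq`).
[cite: Gordon1999HodgeAVSurvey, Thm. 6.4] [cite: White1993SporadicCycles, §4 Theorem 3] [cite: Hazama2003CyclicCM, Rem. 4.10] -/
theorem two_mul_natCard_twistStabilizer_mul_eq_iff_forall_hodgeClassSpan_eq (Φ : CMType K)
    (hA : IsCMTypeRealisation Φ A ι θ) :
    2 * Nat.card (twistStabilizer Φ) * (cmTypeRank Φ - 1) = finrank ℚ K ↔
      ∀ m : ℕ, hodgeClassSpan (finrank ℚ K / 2) A.X m = divisorClassesSpan A.X (finrank ℚ K / 2) m := by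
  rw [two_mul_natCard_twistStabilizer_mul_eq_iff_forall_pow_hodgeClassSpan_eq Φ hA,
    forall_pow_hodgeClassSpan_eq_iff_forall_hodgeClassSpan_eq hA]

/-- **`K` abelian CM, `2·|Stab(Φ)|·(Rank(Φ) − 1) < [K:ℚ]` ⟹ `A` ITSELF CARRIES AN EXCEPTIONAL HODGE CLASS** (a
rational `(m,m)`-class outside `Dᵐ(A) ⊗ ℂ`). [cite: Gordon1999HodgeAVSurvey, Thm. 6.4 and §9.2]
[cite: White1993SporadicCycles, §4 Theorem 3] -/
theorem exists_exceptional_of_two_mul_natCard_twistStabilizer_mul_lt (Φ : CMType K)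
    (hlt : 2 * Nat.card (twistStabilizer Φ) * (cmTypeRank Φ - 1) < finrank ℚ K)
    (hA : IsCMTypeRealisation Φ A ι θ) :
    ∃ m : ℕ, ∃ c : complexBetti A.X (2 * m), IsRationalClass c ∧
      IsOfHodgeType (finrank ℚ K / 2) A.X (2 * m) m m c ∧ c ∉ divisorClassesSpan A.X (finrank ℚ K / 2) m :=
  (exists_exceptional_pow_iff_exists_exceptional hA).1
    (exists_exceptional_pow_of_two_mul_natCard_twistStabilizer_mul_lt Φ hlt hA)

/-- **`K` abelian CM: `2·|Stab(Φ)|·(Rank(Φ) − 1) < [K:ℚ]` ⟺ `A` carries an exceptional Hodge class.**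
[cite: Gordon1999HodgeAVSurvey, Thm. 6.4 and §9.2] [cite: White1993SporadicCycles, §4 Theorem 3] -/
theorem two_mul_natCard_twistStabilizer_mul_lt_iff_exists_exceptional (Φ : CMType K)
    (hA : IsCMTypeRealisation Φ A ι θ) :
    2 * Nat.card (twistStabilizer Φ) * (cmTypeRank Φ - 1) < finrank ℚ K ↔
      ∃ m : ℕ, ∃ c : complexBetti A.X (2 * m), IsRationalClass c ∧
        IsOfHodgeType (finrank ℚ K / 2) A.X (2 * m) m m c ∧ c ∉ divisorClassesSpan A.X (finrank ℚ K / 2) m := by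
  refine ⟨fun hlt => exists_exceptional_of_two_mul_natCard_twistStabilizer_mul_lt Φ hlt hA, ?_⟩
  rintro ⟨m, c, hcQ, hcH, hcD⟩
  rcases (two_mul_natCard_twistStabilizer_mul_cmTypeRank_sub_one_le Φ).eq_or_lt with heq | hlt
  · exact absurd (((two_mul_natCard_twistStabilizer_mul_eq_iff_forall_hodgeClassSpan_eq Φ hA).1 heq m) ▸
      Submodule.subset_span ⟨hcQ, hcH⟩) hcD
  · exact hlt

/-- `K` abelian CM: in the extremal case `A` has NO exceptional Hodge class. [cite: Gordon1999HodgeAVSurvey, Thm. 6.4] -/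
theorem not_exists_exceptional_of_two_mul_natCard_twistStabilizer_mul_eq (Φ : CMType K)
    (heq : 2 * Nat.card (twistStabilizer Φ) * (cmTypeRank Φ - 1) = finrank ℚ K)
    (hA : IsCMTypeRealisation Φ A ι θ) :
    ¬ ∃ m : ℕ, ∃ c : complexBetti A.X (2 * m), IsRationalClass c ∧
        IsOfHodgeType (finrank ℚ K / 2) A.X (2 * m) m m c ∧ c ∉ divisorClassesSpan A.X (finrank ℚ K / 2) m := by
  rw [← two_mul_natCard_twistStabilizer_mul_lt_iff_exists_exceptional Φ hA]
  omega

/-- **THE DICHOTOMY ON `A` (abelian CM field, any CM type, any realisation)**: EITHER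
`2·|Stab(Φ)|·(Rank(Φ) − 1) = [K:ℚ]` and all Hodge classes of `A` (indeed of all its powers) are generated by divisor
classes, OR `2·|Stab(Φ)|·(Rank(Φ) − 1) < [K:ℚ]` and `A` carries an exceptional Hodge class.
[cite: Gordon1999HodgeAVSurvey, Thm. 6.4, §9.2] [cite: White1993SporadicCycles, §4 Theorem 3] -/
theorem hodgeClassSpan_eq_or_exists_exceptional (Φ : CMType K) (hA : IsCMTypeRealisation Φ A ι θ) :
    (2 * Nat.card (twistStabilizer Φ) * (cmTypeRank Φ - 1) = finrank ℚ K ∧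
        ∀ m : ℕ, hodgeClassSpan (finrank ℚ K / 2) A.X m = divisorClassesSpan A.X (finrank ℚ K / 2) m) ∨
      (2 * Nat.card (twistStabilizer Φ) * (cmTypeRank Φ - 1) < finrank ℚ K ∧
        ∃ m : ℕ, ∃ c : complexBetti A.X (2 * m), IsRationalClass c ∧
          IsOfHodgeType (finrank ℚ K / 2) A.X (2 * m) m m c ∧ c ∉ divisorClassesSpan A.X (finrank ℚ K / 2) m) := by
  rcases (two_mul_natCard_twistStabilizer_mul_cmTypeRank_sub_one_le Φ).eq_or_lt with heq | hlt
  · exact Or.inl ⟨heq, (two_mul_natCard_twistStabilizer_mul_eq_iff_forall_hodgeClassSpan_eq Φ hA).1 heq⟩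
  · exact Or.inr ⟨hlt, exists_exceptional_of_two_mul_natCard_twistStabilizer_mul_lt Φ hlt hA⟩

end Literature.AlgebraicGeometry.Pohlmann1968
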